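import Mathlib
import Summits.CriticalPhenomena.PercolationContinuityZ3.Theorems.PercNearOneGluingNoHeavyLowerTailOrientedAntipodalHallOmegaSocket

/-!
# The first-order rigidity socket (CONJECTURE Ω¹ ⇒ the oriented antipodal Hall count)

Helper file for crux `stmt-CriticalPhenomena-4575` (`NoHeavyLowerTail`, route `PercNearOneGluingNoHeavy`),
new-inequality factory seat `prim-ineq-gen-3` (gen 15).  Everything here is PROVED (a reduction).

Setting of `…OmegaSocket` / `…OmegaDeformedSocket`: `f : Finset α → Lab k` monotone, ground set `S`, `D` a family
of subsets of `S` with `f (S \ X) ≠ B`; `G` the one-sided enlargement, `Ψ ⊆ G` the pseudo-sets, `K = G \ Ψ` the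
co-goods above `D`, `M = {S \ X : X ∈ D}` the complemented members.  Two `K × M` matrices:
the plain incidence `A F U = [F ⊆ U]` and the first-order matrix `R F U = [F ⊆ U] · #{E ∈ Ψ : F ⊆ E ⊆ U}`
(the number of pseudo-sets between the co-good `F` and the member `U`).

**CONJECTURE Ω¹ (first-order rigidity, gen 15).**  If `κ₀ : M → ℚ` is a plain dependency (`A κ₀ = 0`) whose
first-order image `R κ₀` is again a plain moment vector (`R κ₀ = A κ₁` for some `κ₁`), then `κ₀ = 0`.
It says that the dependencies among plain member vectors on the co-goods ('invisible points', memo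
FINDINGS-gen15 F15-2 in HOME `run/shared/lean/prim/prim-ineq-gen-3/`) never lift to first order in the
deformation parameter of CONJECTURE Ω_c; it implies Ω_c for generic `c`, and it holds in the EXHAUSTIVE
five-point census (0 lifts among 49 680 plain-dependent runs over 17.6 M (labeling, orientation, sub-family)
runs) and in all random tests of gen 15.

* `card_le_card_of_firstOrder_rigid` — pure linear algebra: for finite types `K, M` and matrices
  `A R : Matrix K M ℚ`, first-order rigidity forces `card M ≤ card K`
  (`ker A` embeds into `ℚ^K / range A` via `R`, plus rank–nullity).
* `card_le_card_goods_above_of_firstOrder_rigid` — the socket: Ω¹ for `(f, S, D)` ⇒ `#D ≤ #goods above D`;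
  `exists_injective_good_above_of_firstOrder_rigid` — SDR form (Ω¹ for all sub-families ⇒ distinct goods).
-/

namespace Summit.CriticalPhenomena.PercolationContinuityZ3.Theorems

namespace OrientedAntipodalHall

open Finset Module AntipodalStrongHarris AntipodalStrongHarris.Lab ThreeFamilyRank
open scoped FinsetFamily

/-- **First-order rigidity forces the count (linear algebra).**  If every `κ₀ ∈ ker A` with `R κ₀ ∈ range A`
vanishes, then `card M ≤ card K`: the map `κ₀ ↦ R κ₀ mod range A` embeds `ker A` into `ℚ^K / range A`,
and rank–nullity gives `card M = dim ker A + dim range A ≤ card K`. -/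
theorem card_le_card_of_firstOrder_rigid {K M : Type*} [Fintype K] [Fintype M] [DecidableEq M]
    (A R : Matrix K M ℚ)
    (hrig : ∀ κ₀ κ₁ : M → ℚ, A.mulVec κ₀ = 0 → A.mulVec κ₁ = R.mulVec κ₀ → κ₀ = 0) :
    Fintype.card M ≤ Fintype.card K := by
  classical
  set a : (M → ℚ) →ₗ[ℚ] (K → ℚ) := A.mulVecLin with ha
  set r : (M → ℚ) →ₗ[ℚ] (K → ℚ) := R.mulVecLin with hr
  -- the composite  ker a → ℚ^K → ℚ^K / range a
  set φ : ↥(LinearMap.ker a) →ₗ[ℚ] (K → ℚ) ⧸ LinearMap.range a :=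
    (LinearMap.range a).mkQ ∘ₗ r ∘ₗ (LinearMap.ker a).subtype with hφ
  have hinj : Function.Injective φ := by
    rw [← LinearMap.ker_eq_bot, LinearMap.ker_eq_bot']
    intro x hx
    have hx' : r (x : M → ℚ) ∈ LinearMap.range a := by
      have : (LinearMap.range a).mkQ (r (x : M → ℚ)) = 0 := by simpa [hφ] using hx
      simpa [Submodule.mkQ_apply, Submodule.Quotient.mk_eq_zero] using this
    obtain ⟨κ₁, hκ₁⟩ := LinearMap.mem_range.mp hx'
    have hker : a (x : M → ℚ) = 0 := LinearMap.mem_ker.mp x.2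
    have h0 : (x : M → ℚ) = 0 := by
      apply hrig (x : M → ℚ) κ₁
      · exact hker
      · exact hκ₁
    exact Subtype.ext h0
  have h1 : finrank ℚ ↥(LinearMap.ker a) ≤ finrank ℚ ((K → ℚ) ⧸ LinearMap.range a) :=
    LinearMap.finrank_le_finrank_of_injective hinj
  have h2 : finrank ℚ ((K → ℚ) ⧸ LinearMap.range a) + finrank ℚ ↥(LinearMap.range a) =
      finrank ℚ (K → ℚ) := Submodule.finrank_quotient_add_finrank _
  have h3 : finrank ℚ ↥(LinearMap.range a) + finrank ℚ ↥(LinearMap.ker a) = finrank ℚ (M → ℚ) :=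
    LinearMap.finrank_range_add_finrank_ker a
  have hK : finrank ℚ (K → ℚ) = Fintype.card K := Module.finrank_fintype_fun_eq_card ℚ
  have hM : finrank ℚ (M → ℚ) = Fintype.card M := Module.finrank_fintype_fun_eq_card ℚ
  omega

variable {α : Type*} [DecidableEq α] {k : ℕ}

/-- **Ω¹-socket, counting form.**  `f : Finset α → Lab k`, `D` a family of subsets of `S`; `G` the
one-sided enlargement, `Ψ` its pseudo-class, `K = {F ∈ G : f (S \ F) = A}`
the co-goods above `D`, `M` the complemented members.  If the pair (plain incidence matrix `[F ⊆ U]`,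
first-order matrix `[F ⊆ U] · #{E ∈ Ψ : F ⊆ E ⊆ U}`) on `K × M` is first-order rigid, then at least `#D` good
sets lie above members of `D`. -/
theorem card_le_card_goods_above_of_firstOrder_rigid (S : Finset α) {f : Finset α → Lab k}
    (D G Ψ K M : Finset (Finset α)) (hDS : ∀ X ∈ D, X ⊆ S)
    (hG : G = {F ∈ S.powerset | f F = bot ∧ f (S \ F) ≠ bot ∧ ∃ X ∈ D, F ⊆ S \ X})
    (_hΨ : Ψ = {F ∈ G | f (S \ F) ≠ top}) (hK : K = {F ∈ G | f (S \ F) = top})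
    (hM : M = D.image (fun X => S \ X))
    (hrig : ∀ κ₀ κ₁ : ↥M → ℚ,
      Matrix.mulVec (Matrix.of fun (F : ↥K) (U : ↥M) =>
          if (F : Finset α) ⊆ (U : Finset α) then (1 : ℚ) else 0) κ₀ = 0 →
      Matrix.mulVec (Matrix.of fun (F : ↥K) (U : ↥M) =>
          if (F : Finset α) ⊆ (U : Finset α) then (1 : ℚ) else 0) κ₁ =
        Matrix.mulVec (Matrix.of fun (F : ↥K) (U : ↥M) => if (F : Finset α) ⊆ (U : Finset α) then
          (#{E ∈ Ψ | (F : Finset α) ⊆ E ∧ E ⊆ (U : Finset α)} : ℚ) else 0) κ₀ →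
      κ₀ = 0) :
    #D ≤ #{U ∈ S.powerset | f U = top ∧ f (S \ U) = bot ∧ ∃ X ∈ D, X ⊆ U} := by
  classical
  -- linear algebra: `#M ≤ #K`
  have hMK : Fintype.card ↥M ≤ Fintype.card ↥K := card_le_card_of_firstOrder_rigid _ _ hrig
  rw [Fintype.card_coe, Fintype.card_coe] at hMK
  -- `#M = #D`
  have hinjD : Set.InjOn (fun X => S \ X) (D : Set (Finset α)) := by
    intro X₁ hX₁ X₂ hX₂ h
    have h₁ := Finset.sdiff_sdiff_eq_self (hDS X₁ hX₁)
    have h₂ := Finset.sdiff_sdiff_eq_self (hDS X₂ hX₂)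
    simp only at h
    rw [← h₁, ← h₂, h]
  have hcardM : #M = #D := by rw [hM]; exact card_image_of_injOn hinjD
  -- `K` injects into the goods above `D` by complementation
  have hKS : ∀ F ∈ K, F ⊆ S := by
    intro F hF
    rw [hK, mem_filter, hG, mem_filter, mem_powerset] at hF
    exact hF.1.1
  have hinjK : Set.InjOn (fun F => S \ F) (K : Set (Finset α)) := by
    intro F₁ hF₁ F₂ hF₂ h
    have h₁ := Finset.sdiff_sdiff_eq_self (hKS F₁ hF₁)
    have h₂ := Finset.sdiff_sdiff_eq_self (hKS F₂ hF₂)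
    simp only at h
    rw [← h₁, ← h₂, h]
  have himg : K.image (fun F => S \ F) ⊆
      {U ∈ S.powerset | f U = top ∧ f (S \ U) = bot ∧ ∃ X ∈ D, X ⊆ U} := by
    intro U hU
    obtain ⟨F, hF, rfl⟩ := mem_image.mp hU
    have hFS := hKS F hF
    rw [hK, mem_filter, hG, mem_filter] at hF
    obtain ⟨⟨-, hFbot, -, X, hX, hFX⟩, hFtop⟩ := hF
    rw [mem_filter, mem_powerset, Finset.sdiff_sdiff_eq_self hFS]
    refine ⟨sdiff_subset, hFtop, hFbot, X, hX, ?_⟩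
    intro a ha
    exact mem_sdiff.mpr ⟨hDS X hX ha, fun haF => (mem_sdiff.mp (hFX haF)).2 ha⟩
  calc #D = #M := hcardM.symm
    _ ≤ #K := hMK
    _ = #(K.image fun F => S \ F) := (card_image_of_injOn hinjK).symm
    _ ≤ #{U ∈ S.powerset | f U = top ∧ f (S \ U) = bot ∧ ∃ X ∈ D, X ⊆ U} := card_le_card himg

/-- **Ω¹-socket, SDR form.**  If first-order rigidity holds for every sub-family of `D`, the members of `D`
have DISTINCT good representatives above them (Conjecture O_k for this labeling and family). -/
theorem exists_injective_good_above_of_firstOrder_rigid (S : Finset α) {f : Finset α → Lab k}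
    (D : Finset (Finset α)) (hDS : ∀ X ∈ D, X ⊆ S)
    (hrig : ∀ D' ⊆ D, ∀ G Ψ K M : Finset (Finset α),
      G = {F ∈ S.powerset | f F = bot ∧ f (S \ F) ≠ bot ∧ ∃ X ∈ D', F ⊆ S \ X} →
      Ψ = {F ∈ G | f (S \ F) ≠ top} → K = {F ∈ G | f (S \ F) = top} → M = D'.image (fun X => S \ X) →
      ∀ κ₀ κ₁ : ↥M → ℚ,
      Matrix.mulVec (Matrix.of fun (F : ↥K) (U : ↥M) =>
          if (F : Finset α) ⊆ (U : Finset α) then (1 : ℚ) else 0) κ₀ = 0 →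
      Matrix.mulVec (Matrix.of fun (F : ↥K) (U : ↥M) =>
          if (F : Finset α) ⊆ (U : Finset α) then (1 : ℚ) else 0) κ₁ =
        Matrix.mulVec (Matrix.of fun (F : ↥K) (U : ↥M) => if (F : Finset α) ⊆ (U : Finset α) then
          (#{E ∈ Ψ | (F : Finset α) ⊆ E ∧ E ⊆ (U : Finset α)} : ℚ) else 0) κ₀ →
      κ₀ = 0) :
    ∃ φ : D → Finset α, Function.Injective φ ∧
      ∀ X : D, (X : Finset α) ⊆ φ X ∧ φ X ⊆ S ∧ f (φ X) = top ∧ f (S \ φ X) = bot := by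
  classical
  let t : D → Finset (Finset α) := fun X =>
    {U ∈ S.powerset | f U = top ∧ f (S \ U) = bot ∧ (X : Finset α) ⊆ U}
  have hHall : ∀ s : Finset D, #s ≤ #(s.biUnion t) := by
    intro s
    set D' : Finset (Finset α) := s.map (Function.Embedding.subtype _) with hD'
    have hD'sub : D' ⊆ D := by
      intro X hX
      obtain ⟨x, -, rfl⟩ := mem_map.mp hX
      exact x.2
    have hcard : #s = #D' := (card_map _).symm
    have hle := card_le_card_goods_above_of_firstOrder_rigid S D' _ _ _ _
      (fun X hX => hDS X (hD'sub hX)) rfl rfl rfl rfl (hrig D' hD'sub _ _ _ _ rfl rfl rfl rfl)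
    have hgoods : {U ∈ S.powerset | f U = top ∧ f (S \ U) = bot ∧ ∃ X ∈ D', X ⊆ U} ⊆
        s.biUnion t := by
      intro U hU
      rw [mem_filter, mem_powerset] at hU
      obtain ⟨hUS, hUtop, hUbot, X, hX, hXU⟩ := hU
      obtain ⟨x, hx, rfl⟩ := mem_map.mp hX
      rw [mem_biUnion]
      refine ⟨x, hx, ?_⟩
      simp only [t, mem_filter, mem_powerset]
      exact ⟨hUS, hUtop, hUbot, hXU⟩
    calc #s = #D' := hcard
      _ ≤ #{U ∈ S.powerset | f U = top ∧ f (S \ U) = bot ∧ ∃ X ∈ D', X ⊆ U} := hle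
      _ ≤ #(s.biUnion t) := card_le_card hgoods
  obtain ⟨φ, hφinj, hφ⟩ := (all_card_le_biUnion_card_iff_exists_injective t).mp hHall
  refine ⟨φ, hφinj, fun X => ?_⟩
  have hX := hφ X
  simp only [t, mem_filter, mem_powerset] at hX
  exact ⟨hX.2.2.2, hX.1, hX.2.1, hX.2.2.1⟩

end OrientedAntipodalHall

end Summit.CriticalPhenomena.PercolationContinuityZ3.Theorems
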